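import Literature.MathematicalPhysics.QuantumManyBody.BoseEinsteinCondensation
import Mathlib.Algebra.Module.ZLattice.Basic
import Mathlib.MeasureTheory.Group.FundamentalDomain
import HarnessLib

/-!
# The sliding average over the cubic lattice (Lieb–Solovej 2001, proof of Lemma 3.1)

Topic `Literature/MathematicalPhysics/QuantumManyBody` (groundwork for the charged Bose gas,
`JelliumBoseGas.foldyLaw`). The sliding localization of [ConlonLiebYau1988; LiebSolovej2001,
Lemma 3.1; LSSY2005, Thm. 10.5] averages a localized two-body kernel over all positions of the
localizing cube: "We calculate
`∑_{λ∈ℤ³} ∫_{μ∈[-½,½]³} dμ γχ(x + (μ+λ)) Y_ω(x - y) χ(y + (μ+λ)) = ∫ γχ(x + z)Y_ω(x - y)χ(y + z) dz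
 = h(x - y) Y_ω(x - y)`, where we have set `h = γχ∗χ`" [LiebSolovej2001, proof of Lemma 3.1].
Two facts are behind this: the unit cubes `λ + [0,1)³`, `λ ∈ ℤ³`, tile `ℝ³`, so that
`∑_λ ∫_{[0,1)³} f(λ + μ) dμ = ∫_{ℝ³} f` for integrable `f` (Mathlib: the ℤ-span of the standard
basis has the fundamental domain `ZSpan.fundamentalDomain` = `[0,1)³`,
`IsAddFundamentalDomain.integral_eq_tsum''`), and translation invariance
`∫ χ(x + z) χ(y + z) dz = ∫ χ(u) χ(u - (x - y)) du`.

* `Coulomb.integral_eq_tsum_integral_unitCube` — **`∫_{ℝ³} f = ∑_{λ ∈ ℤ³} ∫_{[0,1)³} f(λ + μ) dμ`**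
  for `f ∈ L¹(ℝ³)` (lattice = `Submodule.span ℤ` of the standard basis of `ℝ³`, as an additive
  subgroup; cube = `ZSpan.fundamentalDomain` of that basis, i.e. `{μ | ∀ k, μ_k ∈ [0,1)}`).
* `Coulomb.integral_mul_translate` — `∫ χ(x + z) χ(y + z) dz = ∫ χ(u) χ(u - (x - y)) du`.
* `Coulomb.sliding_average` — **the displayed identity**: for continuous compactly supported `χ`
  and any value `K` (`= γ Y_ω(x - y)`),
  `∑_{λ∈ℤ³} ∫_{[0,1)³} χ(x + (λ + μ)) K χ(y + (λ + μ)) dμ = (∫ χ(u)χ(u - (x - y)) du) K`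
  (the cube `[-½,½]³` of the source is `[0,1)³` up to relabelling `μ`).

## References

* [LiebSolovej2001] E. H. Lieb, J. P. Solovej, Commun. Math. Phys. 217 (2001) 127–163, Lemma 3.1
  (proof) (arXiv:cond-mat/0007425, p. 8).
* [ConlonLiebYau1988] J. G. Conlon, E. H. Lieb, H.-T. Yau, Commun. Math. Phys. 116 (1988) 417–448,
  Lemma 2.1.
* [LSSY2005] Thm. 10.5 (arXiv Thm. 12.4).
-/

noncomputable section

open MeasureTheory Set Filter Real
open scoped ENNReal NNReal Topology

namespace Literature.MathematicalPhysics.QuantumManyBody.Coulomb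

open BoseGas

/-- The unit cube `[0,1)³ ⊂ ℝ³` as the `ZSpan` fundamental domain of the standard basis:
`μ ∈ ZSpan.fundamentalDomain (basisFun) ↔ ∀ k, μ_k ∈ [0, 1)`. [folklore] -/
theorem mem_fundamentalDomain_basisFun_iff (m : Space) :
    m ∈ ZSpan.fundamentalDomain (EuclideanSpace.basisFun (Fin 3) ℝ).toBasis ↔
      ∀ k, m k ∈ Ico (0 : ℝ) 1 := by
  rw [ZSpan.mem_fundamentalDomain]
  simp only [OrthonormalBasis.coe_toBasis_repr_apply, EuclideanSpace.basisFun_repr]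

/-- **The unit cubes tile `ℝ³`**: for `f ∈ L¹(ℝ³)`,
`∫_{ℝ³} f = ∑_{λ ∈ ℤ³} ∫_{[0,1)³} f(λ + μ) dμ`, the lattice `ℤ³` being the `ℤ`-span of the
standard basis and the cube its `ZSpan` fundamental domain. [cite: LiebSolovej2001, Lemma 3.1 (proof)] -/
theorem integral_eq_tsum_integral_unitCube (f : Space → ℝ) (hf : Integrable f) :
    ∫ z, f z = ∑' g : (Submodule.span ℤ (Set.range (EuclideanSpace.basisFun (Fin 3) ℝ).toBasis)).toAddSubgroup,
      ∫ μ in ZSpan.fundamentalDomain (EuclideanSpace.basisFun (Fin 3) ℝ).toBasis, f ((g : Space) + μ) := by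
  haveI : Countable (Submodule.span ℤ (Set.range (EuclideanSpace.basisFun (Fin 3) ℝ).toBasis)).toAddSubgroup :=
    inferInstanceAs (Countable (Submodule.span ℤ (Set.range (EuclideanSpace.basisFun (Fin 3) ℝ).toBasis)))
  haveI : MeasurableConstVAdd
      (Submodule.span ℤ (Set.range (EuclideanSpace.basisFun (Fin 3) ℝ).toBasis)).toAddSubgroup Space :=
    ⟨fun g => measurable_const_add (g : Space)⟩
  have h := (ZSpan.isAddFundamentalDomain' (EuclideanSpace.basisFun (Fin 3) ℝ).toBasis
    (volume : Measure Space)).integral_eq_tsum'' f hf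
  rw [h]
  rfl

/-- Translation: `∫ χ(x + z) ψ(y + z) dz = ∫ χ(u) ψ(u - (x - y)) du`. [folklore] -/
theorem integral_mul_translate (χ ψ : Space → ℝ) (x y : Space) :
    ∫ z : Space, χ (x + z) * ψ (y + z) = ∫ u : Space, χ u * ψ (u - (x - y)) := by
  have h := integral_add_left_eq_self (μ := (volume : Measure Space))
    (fun u : Space => χ u * ψ (u - (x - y))) x
  rw [← h]
  refine integral_congr_ae (Eventually.of_forall fun z => ?_)
  simp only
  congr 2
  abel

/-- A continuous compactly supported `χ` makes `z ↦ χ(x + z) · K · χ(y + z)` integrable. [folklore] -/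
theorem integrable_translate_mul (χ : Space → ℝ) (hχ : Continuous χ) (hsupp : HasCompactSupport χ)
    (K : ℝ) (x y : Space) : Integrable fun z : Space => χ (x + z) * K * χ (y + z) := by
  have h1 : Integrable fun z : Space => χ (x + z) :=
    (hχ.integrable_of_hasCompactSupport hsupp : Integrable χ volume).comp_add_left x
  have h2 : Continuous fun z : Space => K * χ (y + z) :=
    continuous_const.mul (hχ.comp (continuous_const.add continuous_id))
  obtain ⟨C, hC⟩ := (hχ.norm.bddAbove_range_of_hasCompactSupport hsupp.norm)
  refine (h1.mul_bdd (c := ‖K‖ * C) h2.aestronglyMeasurable (Eventually.of_forall fun z => ?_)).congr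
    (Eventually.of_forall fun z => by simp only; ring)
  rw [norm_mul]
  exact mul_le_mul_of_nonneg_left (hC ⟨y + z, rfl⟩) (norm_nonneg _)

/-- **The sliding average** [LiebSolovej2001, proof of Lemma 3.1]: for a continuous compactly
supported `χ` on `ℝ³`, points `x, y` and a number `K` (`= γ Y_ω(x - y)` in the source),
`∑_{λ ∈ ℤ³} ∫_{[0,1)³} χ(x + (λ + μ)) K χ(y + (λ + μ)) dμ = (∫ χ(u) χ(u - (x - y)) du) · K`, i.e.
the lattice average of the localized kernels `χ(x + ·) K χ(y + ·)` is `h(x - y) K` with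
`h = χ ∗ χ(-·)`. [cite: LiebSolovej2001, Lemma 3.1 (proof)] -/
theorem sliding_average (χ : Space → ℝ) (hχ : Continuous χ) (hsupp : HasCompactSupport χ)
    (K : ℝ) (x y : Space) :
    ∑' g : (Submodule.span ℤ (Set.range (EuclideanSpace.basisFun (Fin 3) ℝ).toBasis)).toAddSubgroup,
        ∫ μ in ZSpan.fundamentalDomain (EuclideanSpace.basisFun (Fin 3) ℝ).toBasis,
          χ (x + ((g : Space) + μ)) * K * χ (y + ((g : Space) + μ)) =
      (∫ u : Space, χ u * χ (u - (x - y))) * K := by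
  rw [← integral_eq_tsum_integral_unitCube (fun z => χ (x + z) * K * χ (y + z))
    (integrable_translate_mul χ hχ hsupp K x y), ← integral_mul_translate χ χ x y, ← integral_mul_const]
  refine integral_congr_ae (Eventually.of_forall fun z => ?_)
  simp only
  ring

end Literature.MathematicalPhysics.QuantumManyBody.Coulomb
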